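import Mathlib.Combinatorics.SimpleGraph.Clique
import Mathlib.Combinatorics.SimpleGraph.Coloring.EdgeLabeling
import Mathlib.Data.Sym.Card
import Mathlib.Data.Nat.Choose.Cast
import Mathlib.Logic.Equiv.Fin.Basic
import Mathlib.Tactic.FieldSimp
import Mathlib.Tactic.Ring
import Mathlib.Tactic.Linarith
import Mathlib.Tactic.Push
import HarnessLib

/-!
# Ramsey arrowing `F → (G)_r`, clique arrowing `F → (K_k)_r`, and the 2-density `m₂`

The vocabulary of (random) Ramsey theory for graphs, after Rödl–Ruciński (1995) and
Nenadov–Steger (2016):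

* `Arrows F G r` — Rödl–Ruciński's `F → (G)_r` ("`F` is `(G, r)`-Ramsey", JAMS 1995 p. 917:
  "for every coloring of the edges of a graph `F` with `r` colors there is in `F` a subgraph
  isomorphic to `G` whose edges are all colored by the same color"), phrased with Mathlib's
  `SimpleGraph.EdgeLabeling` (an `r`-colouring of `E(F)` is `C : F.EdgeLabeling (Fin r)`, its
  colour classes are `C.labelGraph i`) and `SimpleGraph.IsContained` (`G ⊑ H`, a not necessarily
  induced copy).
* `ArrowsCliques G k r` — the clique case `G → (K_k)_r` in the ELEMENTARY form requested by route
  PneNP/RamseyThreshold (which inlines the case `r = 2`, colours `Bool`): every colouring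
  `c : Sym2 V → Fin r` of ALL unordered pairs admits a `k`-clique `S` of `G`
  (`G.IsNClique k S`) and a colour `i` with `c s(u, v) = i` for all `u ≠ v` in `S`. Colouring all
  pairs rather than only the edges of `G` changes nothing (the pairs inside a clique of `G` are
  edges of `G`): `arrowsCliques_iff_edgeLabeling`, and `arrowsCliques_iff_arrows_top` identifies
  it with `Arrows G ⊤ r` for `⊤ : SimpleGraph (Fin k)`, both for `r ≥ 1`.
  API: colour-type invariance `arrowsCliques_iff_of_equiv`, the `Bool` forms
  `arrowsCliques_two_iff` / `not_arrowsCliques_two_iff` (literally the route's inlined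
  arrowing / non-arrowing predicates), monotonicity in the graph (`ArrowsCliques.of_copy`,
  `.of_isContained`, `.mono`), antitonicity in `k` (`ArrowsCliques.anti`), one colour
  (`arrowsCliques_one_iff`), `not_arrowsCliques_of_cliqueFree`.
* `induceEdgeCard H U = e(H[U])`, `d2Density H U = d₂(H[U]) = (e(H[U]) - 1)/(|U| - 2)` and the
  **2-density** `m2Density H = m₂(H) = max {d₂(J) : J ⊆ H, v_J ≥ 3}` (Rödl–Ruciński 1995 p. 917,
  `m_G^{(2)}`; Nenadov–Steger p. 1: "For every graph `G` on at least 3 vertices we set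
  `d₂(G) = (e_G - 1)/(v_G - 2)` … `m₂(G) = max_{J ⊆ G, v_J ≥ 3} d₂(J)`"), with
  `m2Density_top_fin : m₂(K_k) = (k + 1)/2` for `k ≥ 3` (Rödl–Ruciński Cor. 1: the threshold for
  `K_k` is `n^{-2/(k+1)}`, e.g. `n^{-1/2}` for triangles and `n^{-2/5}` for `K₄`).

## Design notes

* `m₂` ranges over vertex sets `U` with `|U| ≥ 3` and counts ALL edges of `H` inside `U`
  (induced subgraphs): a subgraph `J ⊆ H` on the vertex set `U` has `e_J ≤ e(H[U])` and
  `x ↦ (x - 1)/(|U| - 2)` is increasing, so the printed maximum over all subgraphs is the same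
  number (`d2Density_mono` records the monotonicity in the edge set). Values in `ℚ` (like Mathlib's
  `SimpleGraph.edgeDensity`); cast to `ℝ` at the point of use (`n ^ (-1 / (m₂ : ℝ))`).
* JUNK VALUE: for `Fintype.card V < 3` the maximum is over the empty family and
  `m2Density H = 0` (`m2Density_of_card_lt`); the sources only define `m₂` for `v_G ≥ 3`
  (Nenadov–Steger additionally use the convention `m₂(K₂) = 1/2`, not needed for cliques
  `K_k`, `k ≥ 3`, and NOT encoded here).
* `r = 0`: `ArrowsCliques G k 0` is vacuously true as soon as `V` is nonempty (there is no map
  `Sym2 V → Fin 0`), whereas `Arrows` quantifies over labellings of `E(G)` only; hence the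
  bridges assume `[NeZero r]`. All sources have `r ≥ 2`.
* Mathlib (searched `Ramsey`, `arrows`, `monochromatic`, `labelGraph`, `m2`/`density`): has
  `SimpleGraph.EdgeLabeling`, `EdgeLabeling.labelGraph`, `TopEdgeLabeling`, `IsContained`,
  `IsNClique`/`CliqueFree`, `not_cliqueFree_iff_top_isContained`, but no arrowing predicate, no
  Ramsey numbers for graphs and no 2-density.

## Not here

Ramsey's theorem itself (finiteness of Ramsey numbers), the Rödl–Ruciński threshold theorem
(JAMS 1995 Thm 1/1'; Nenadov–Steger Thm 1) — a separate named fact about `G(n, p)` to be vendored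
on top of this vocabulary — and the CNF encoding of non-arrowing used by SOS statements
(`Literature/Combinatorics/SimpleGraph/NonArrowingCNF.lean`).

## References

* [RodlRucinski1995] V. Rödl, A. Ruciński, *Threshold functions for Ramsey properties*, J. Amer.
  Math. Soc. 8 (1995) 917–942: §1 p. 917 (`F → (G)_r`, `m_G^{(2)}`), Thm 1 / Thm 1' (p. 919),
  Cor. 1 (p. 918, `K_k`: threshold `n^{2k/(k+1)}` edges). Read via `lit read` (pp. 1–3).
* [NenadovSteger2014] R. Nenadov, A. Steger, *A short proof of the random Ramsey theorem*,
  Combin. Probab. Comput. 25 (2016) 130–144: §1 p. 1 (`d₂`, `m₂`, `G → (F)^e_r`, Thm 1).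
  Read via `lit read` (pp. 1–2).
-/

namespace Literature.Combinatorics.SimpleGraph

open Finset
open _root_.SimpleGraph

variable {V W X : Type*}

/-! ### Arrowing -/

section Arrows

/-- **Ramsey arrowing** `F → (G)_r` (Rödl–Ruciński: "`F` is `(G, r)`-Ramsey"): every labelling of
the edges of `F` with `r` colours has a colour class `C.labelGraph i` containing a (not
necessarily induced) copy of `G`. JAMS 1995, p. 917: "for every coloring of the edges of a graph
`F` with `r` colors there is in `F` a subgraph isomorphic to `G` whose edges are all colored by the
same color"; Nenadov–Steger p. 1 write `G → (F)^e_r`.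
[cite: RodlRucinski1995, §1 (p. 917)] -/
def Arrows (F : _root_.SimpleGraph V) (G : _root_.SimpleGraph W) (r : ℕ) : Prop :=
  ∀ C : F.EdgeLabeling (Fin r), ∃ i : Fin r, G ⊑ C.labelGraph i

/-- **Clique arrowing** `G → (K_k)_r` in elementary form: every colouring `c` of the unordered
pairs of vertices with `r` colours admits a `k`-clique `S` of `G` all of whose pairs of distinct
vertices get one colour `i`. (Pairs that are not edges of `G`, and diagonal pairs `s(v, v)`, are
coloured too, irrelevantly: see `arrowsCliques_iff_edgeLabeling` and
`arrowsCliques_iff_arrows_top` for the equivalence with `Arrows G ⊤ r`, `r ≥ 1`.) Route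
PneNP/RamseyThreshold inlines the case `r = 2` with colours `Bool` (`arrowsCliques_two_iff`).
[cite: RodlRucinski1995, §1 (p. 917) and Cor. 1 (p. 918)] -/
def ArrowsCliques (G : _root_.SimpleGraph V) (k r : ℕ) : Prop :=
  ∀ c : Sym2 V → Fin r, ∃ S : Finset V, G.IsNClique k S ∧
    ∃ i : Fin r, ∀ u ∈ S, ∀ v ∈ S, u ≠ v → c s(u, v) = i

/-- The colour type only matters up to bijection: for any `κ ≃ Fin r`, `G → (K_k)_r` says that
every `κ`-colouring of the pairs has a monochromatic `k`-clique of `G`. [folklore] -/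
theorem arrowsCliques_iff_of_equiv {κ : Type*} (G : _root_.SimpleGraph V) (k : ℕ) {r : ℕ}
    (e : κ ≃ Fin r) :
    ArrowsCliques G k r ↔ ∀ c : Sym2 V → κ, ∃ S : Finset V, G.IsNClique k S ∧
      ∃ i : κ, ∀ u ∈ S, ∀ v ∈ S, u ≠ v → c s(u, v) = i := by
  constructor
  · intro h c
    obtain ⟨S, hS, i, hi⟩ := h (e ∘ c)
    refine ⟨S, hS, e.symm i, fun u hu v hv huv => ?_⟩
    rw [← hi u hu v hv huv]
    simp
  · intro h c
    obtain ⟨S, hS, i, hi⟩ := h (e.symm ∘ c)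
    refine ⟨S, hS, e i, fun u hu v hv huv => ?_⟩
    rw [← hi u hu v hv huv]
    simp

/-- The two-colour case with colours `Bool` — literally the arrowing predicate inlined in route
PneNP/RamseyThreshold (`RodlRucinskiK4`, `RandomRamseyHypothesis`, with `k = 4`). [folklore] -/
theorem arrowsCliques_two_iff (G : _root_.SimpleGraph V) (k : ℕ) :
    ArrowsCliques G k 2 ↔ ∀ c : Sym2 V → Bool, ∃ S : Finset V, G.IsNClique k S ∧
      ∃ b : Bool, ∀ u ∈ S, ∀ v ∈ S, u ≠ v → c s(u, v) = b :=
  arrowsCliques_iff_of_equiv G k finTwoEquiv.symm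

/-- NON-arrowing with two colours, `G ↛ (K_k)_2`: some `Bool`-colouring of the pairs leaves no
`k`-clique of `G` monochromatic — literally the predicate inlined in route PneNP/RamseyThreshold
(`QuietNonArrowingPlanting`, `NonArrowingMemNP`, with `k = 4`). [folklore] -/
theorem not_arrowsCliques_two_iff (G : _root_.SimpleGraph V) (k : ℕ) :
    ¬ ArrowsCliques G k 2 ↔ ∃ c : Sym2 V → Bool, ∀ S : Finset V, G.IsNClique k S →
      ∀ b : Bool, ∃ u ∈ S, ∃ v ∈ S, u ≠ v ∧ c s(u, v) ≠ b := by
  rw [arrowsCliques_two_iff]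
  push Not
  rfl

/-- Colouring all pairs or only the edges of `G` is the same thing (`r ≥ 1`): `G → (K_k)_r` iff
every `r`-labelling `C` of `E(G)` has a colour class `C.labelGraph i` containing a `k`-clique.
[folklore] -/
theorem arrowsCliques_iff_edgeLabeling (G : _root_.SimpleGraph V) (k r : ℕ) [NeZero r] :
    ArrowsCliques G k r ↔
      ∀ C : G.EdgeLabeling (Fin r), ∃ (i : Fin r) (S : Finset V), (C.labelGraph i).IsNClique k S := by
  classical
  constructor
  · intro h C
    obtain ⟨S, hS, i, hi⟩ := h (fun e => if he : e ∈ G.edgeSet then C ⟨e, he⟩ else 0)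
    refine ⟨i, S, ?_, hS.2⟩
    intro u hu v hv huv
    rw [EdgeLabeling.labelGraph_adj]
    have hadj : G.Adj u v := hS.1 hu hv huv
    have hc := hi u hu v hv huv
    rw [dif_pos ((mem_edgeSet G).2 hadj)] at hc
    exact ⟨hadj, hc⟩
  · intro h c
    obtain ⟨i, S, hS⟩ := h (fun e => c e.1)
    refine ⟨S, ⟨fun u hu v hv huv => EdgeLabeling.labelGraph_le _ (hS.1 hu hv huv), hS.2⟩, i, ?_⟩
    intro u hu v hv huv
    obtain ⟨_, hH⟩ := (EdgeLabeling.labelGraph_adj u v).1 (hS.1 hu hv huv)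
    exact hH

/-- `G → (K_k)_r` (`r ≥ 1`) iff every `r`-labelling of `E(G)` has a colour class which is not
`k`-clique-free. [folklore] -/
theorem arrowsCliques_iff_not_cliqueFree (G : _root_.SimpleGraph V) (k r : ℕ) [NeZero r] :
    ArrowsCliques G k r ↔ ∀ C : G.EdgeLabeling (Fin r), ∃ i : Fin r, ¬ (C.labelGraph i).CliqueFree k := by
  simp only [arrowsCliques_iff_edgeLabeling, CliqueFree, not_forall, not_not]

/-- The elementary clique arrowing IS Rödl–Ruciński's `G → (K_k)_r` (`r ≥ 1`), `K_k` being
Mathlib's `⊤ : SimpleGraph (Fin k)`. [cite: RodlRucinski1995, §1 (p. 917)] -/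
theorem arrowsCliques_iff_arrows_top (G : _root_.SimpleGraph V) (k r : ℕ) [NeZero r] :
    ArrowsCliques G k r ↔ Arrows G (⊤ : _root_.SimpleGraph (Fin k)) r := by
  simp only [arrowsCliques_iff_not_cliqueFree, Arrows, not_cliqueFree_iff_top_isContained,
    completeGraph_eq_top]

/-- Arrowing is monotone along copies: if `G` has an (injective, not necessarily induced) copy in
`H` and `G → (K_k)_r` then `H → (K_k)_r` (pull the colouring back, push the clique forward).
In particular it is a monotone graph property (Rödl–Ruciński p. 918). [folklore] -/
theorem ArrowsCliques.of_copy {G : _root_.SimpleGraph V} {H : _root_.SimpleGraph W} {k r : ℕ}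
    (f : G.Copy H) (h : ArrowsCliques G k r) : ArrowsCliques H k r := by
  intro c
  obtain ⟨S, hS, i, hi⟩ := h (fun e => c (e.map f))
  refine ⟨S.map ⟨f, f.injective⟩, ⟨?_, by rw [card_map, hS.2]⟩, i, ?_⟩
  · intro x hx y hy hxy
    simp only [coe_map, Function.Embedding.coeFn_mk, Set.mem_image, mem_coe] at hx hy
    obtain ⟨u, hu, rfl⟩ := hx
    obtain ⟨v, hv, rfl⟩ := hy
    exact f.toHom.map_adj (hS.1 hu hv fun huv => hxy (congrArg f huv))
  · intro x hx y hy hxy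
    simp only [mem_map, Function.Embedding.coeFn_mk] at hx hy
    obtain ⟨u, hu, rfl⟩ := hx
    obtain ⟨v, hv, rfl⟩ := hy
    have huv : u ≠ v := fun huv => hxy (congrArg f huv)
    simpa using hi u hu v hv huv

/-- Arrowing is monotone in the graph: `G ≤ H`, `G → (K_k)_r` ⟹ `H → (K_k)_r`. [folklore] -/
theorem ArrowsCliques.mono {G H : _root_.SimpleGraph V} {k r : ℕ} (hGH : G ≤ H)
    (h : ArrowsCliques G k r) : ArrowsCliques H k r :=
  h.of_copy (Copy.ofLE G H hGH)

/-- Arrowing passes to any graph containing a copy: `G ⊑ H`, `G → (K_k)_r` ⟹ `H → (K_k)_r`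
(in particular it is invariant under graph isomorphism). [folklore] -/
theorem ArrowsCliques.of_isContained {G : _root_.SimpleGraph V} {H : _root_.SimpleGraph W}
    {k r : ℕ} (hGH : G ⊑ H) (h : ArrowsCliques G k r) : ArrowsCliques H k r := by
  obtain ⟨f⟩ := hGH
  exact h.of_copy f

/-- Arrowing is antitone in the clique size: `k' ≤ k`, `G → (K_k)_r` ⟹ `G → (K_{k'})_r`
(a sub-clique of a monochromatic clique is monochromatic). [folklore] -/
theorem ArrowsCliques.anti {G : _root_.SimpleGraph V} {k k' r : ℕ} (hk : k' ≤ k)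
    (h : ArrowsCliques G k r) : ArrowsCliques G k' r := by
  intro c
  obtain ⟨S, hS, i, hi⟩ := h c
  obtain ⟨T, hTS, hT⟩ := Finset.exists_subset_card_eq (show k' ≤ #S by rw [hS.2]; exact hk)
  exact ⟨T, ⟨hS.1.subset (Finset.coe_subset.2 hTS), hT⟩, i,
    fun u hu v hv huv => hi u (hTS hu) v (hTS hv) huv⟩

/-- One colour: `G → (K_k)_1` iff `G` contains a `k`-clique. [folklore] -/
theorem arrowsCliques_one_iff (G : _root_.SimpleGraph V) (k : ℕ) :
    ArrowsCliques G k 1 ↔ ¬ G.CliqueFree k := by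
  constructor
  · intro h hfree
    obtain ⟨S, hS, -⟩ := h (fun _ => 0)
    exact hfree S hS
  · intro h c
    simp only [CliqueFree, not_forall, not_not] at h
    obtain ⟨S, hS⟩ := h
    exact ⟨S, hS, 0, fun u _ v _ _ => Subsingleton.elim _ _⟩

/-- A `k`-clique-free graph arrows nothing of size `k` (as soon as there is a colour, `r ≥ 1`).
[folklore] -/
theorem not_arrowsCliques_of_cliqueFree {G : _root_.SimpleGraph V} {k r : ℕ} [NeZero r]
    (hG : G.CliqueFree k) : ¬ ArrowsCliques G k r := by
  intro h
  obtain ⟨S, hS, -⟩ := h (fun _ => 0)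
  exact hG S hS

/-- `F → (G)_r` is antitone in the target: `G' ⊑ G`, `F → (G)_r` ⟹ `F → (G')_r`. [folklore] -/
theorem Arrows.anti_right {F : _root_.SimpleGraph V} {G : _root_.SimpleGraph W}
    {G' : _root_.SimpleGraph X} {r : ℕ} (hG : G' ⊑ G) (h : Arrows F G r) : Arrows F G' r := by
  intro C
  obtain ⟨i, hi⟩ := h C
  exact ⟨i, hG.trans hi⟩

/-- `F → (G)_r` is a monotone property of `F` along copies: `Copy F F'`, `F → (G)_r` ⟹
`F' → (G)_r` (restrict the labelling of `E(F')` to the copy of `F`). Rödl–Ruciński p. 918: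
"`F → (G)_r` is a monotone graph property". [cite: RodlRucinski1995, §1 (p. 918)] -/
theorem Arrows.of_copy {F : _root_.SimpleGraph V} {F' : _root_.SimpleGraph W}
    {G : _root_.SimpleGraph X} {r : ℕ} (f : F.Copy F') (h : Arrows F G r) : Arrows F' G r := by
  intro C'
  obtain ⟨i, hi⟩ := h (C'.pullback f.toHom)
  refine ⟨i, hi.trans ⟨⟨⟨f, ?_⟩, f.injective⟩⟩⟩
  intro a b hab
  rw [EdgeLabeling.labelGraph_adj] at hab ⊢
  obtain ⟨H, hH⟩ := hab
  refine ⟨f.toHom.map_adj H, ?_⟩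
  rw [EdgeLabeling.pullback_apply] at hH
  convert hH using 2
  exact Subtype.ext (by simp)

/-- `F ≤ F'`, `F → (G)_r` ⟹ `F' → (G)_r`. [cite: RodlRucinski1995, §1 (p. 918)] -/
theorem Arrows.mono_left {F F' : _root_.SimpleGraph V} {G : _root_.SimpleGraph W} {r : ℕ}
    (hF : F ≤ F') (h : Arrows F G r) : Arrows F' G r :=
  h.of_copy (Copy.ofLE F F' hF)

end Arrows

/-! ### The 2-density `m₂` -/

section TwoDensity

/-- `e(H[U])`: the number of edges of `H` with both ends in the vertex set `U` (edges of the
induced subgraph `H[U]`), counted as the unordered pairs from `U` lying in `H.edgeSet`.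
[cite: NenadovSteger2014, §1 (p. 1)] -/
def induceEdgeCard (H : _root_.SimpleGraph V) [DecidableRel H.Adj] (U : Finset V) : ℕ :=
  #{e ∈ U.sym2 | e ∈ H.edgeSet}

/-- `d₂(H[U]) = (e(H[U]) - 1) / (|U| - 2)` (Nenadov–Steger p. 1: "For every graph `G` on at least
3 vertices we set `d₂(G) = (e_G - 1)/(v_G - 2)`"), a rational number; meaningful for `|U| ≥ 3`
(for `|U| = 2` the denominator is `0` and the value is the junk `x / 0 = 0`).
[cite: NenadovSteger2014, §1 (p. 1)] -/
def d2Density (H : _root_.SimpleGraph V) [DecidableRel H.Adj] (U : Finset V) : ℚ :=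
  ((induceEdgeCard H U : ℚ) - 1) / ((#U : ℚ) - 2)

/-- More edges inside `U`, more induced edges: `e(H₁[U]) ≤ e(H₂[U])` for `H₁ ≤ H₂`. [folklore] -/
theorem induceEdgeCard_mono {H₁ H₂ : _root_.SimpleGraph V} [DecidableRel H₁.Adj]
    [DecidableRel H₂.Adj] (h : H₁ ≤ H₂) (U : Finset V) :
    induceEdgeCard H₁ U ≤ induceEdgeCard H₂ U := by
  unfold induceEdgeCard
  apply card_le_card
  intro e he
  simp only [mem_filter] at he ⊢
  exact ⟨he.1, edgeSet_subset_edgeSet.2 h he.2⟩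

/-- `d₂` is monotone in the edge set on vertex sets of size `≥ 3` — the reason the maximum over
induced subgraphs equals the printed maximum over all subgraphs. [folklore] -/
theorem d2Density_mono {H₁ H₂ : _root_.SimpleGraph V} [DecidableRel H₁.Adj]
    [DecidableRel H₂.Adj] (h : H₁ ≤ H₂) {U : Finset V} (hU : 3 ≤ #U) :
    d2Density H₁ U ≤ d2Density H₂ U := by
  unfold d2Density
  have h3 : (3 : ℚ) ≤ #U := by exact_mod_cast hU
  have h2 : (0 : ℚ) ≤ (#U : ℚ) - 2 := by linarith
  have hle : (induceEdgeCard H₁ U : ℚ) ≤ induceEdgeCard H₂ U := by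
    exact_mod_cast induceEdgeCard_mono h U
  exact div_le_div_of_nonneg_right (by linarith) h2

/-- In the complete graph every pair of distinct vertices of `U` is an edge:
`e(K[U]) = (|U| choose 2)`. [folklore] -/
theorem induceEdgeCard_top [DecidableEq V] [DecidableRel (⊤ : _root_.SimpleGraph V).Adj]
    (U : Finset V) : induceEdgeCard (⊤ : _root_.SimpleGraph V) U = (#U).choose 2 := by
  rw [induceEdgeCard, ← Sym2.card_image_offDiag]
  congr 1
  ext e
  induction e using Sym2.ind with
  | _ a b =>
    simp only [mem_filter, mk_mem_sym2_iff, mem_edgeSet, top_adj, mem_image, mem_offDiag,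
      Prod.exists, Function.uncurry_apply_pair]
    constructor
    · rintro ⟨⟨ha, hb⟩, hab⟩
      exact ⟨a, b, ⟨ha, hb, hab⟩, rfl⟩
    · rintro ⟨x, y, ⟨hx, hy, hxy⟩, hxyab⟩
      rcases Sym2.eq_iff.1 hxyab with ⟨rfl, rfl⟩ | ⟨rfl, rfl⟩
      · exact ⟨⟨hx, hy⟩, hxy⟩
      · exact ⟨⟨hy, hx⟩, fun h => hxy h.symm⟩

/-- `d₂(K_j) = ((j choose 2) - 1)/(j - 2) = (j + 1)/2` for `j = |U| ≥ 3`. [folklore] -/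
theorem d2Density_top [DecidableEq V] [DecidableRel (⊤ : _root_.SimpleGraph V).Adj]
    {U : Finset V} (hU : 3 ≤ #U) :
    d2Density (⊤ : _root_.SimpleGraph V) U = ((#U : ℚ) + 1) / 2 := by
  rw [d2Density, induceEdgeCard_top, Nat.cast_choose_two]
  have h3 : (3 : ℚ) ≤ #U := by exact_mod_cast hU
  have h2 : ((#U : ℚ) - 2) ≠ 0 := by
    intro h0
    linarith
  rw [div_eq_div_iff h2 two_ne_zero]
  ring

variable [Fintype V]

/-- The **2-density** `m₂(H) = max {d₂(J) : J ⊆ H, v_J ≥ 3}` of a finite graph (Rödl–Ruciński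
1995 p. 917, `m_G^{(2)} = max_{H ⊆ G, v_H ≥ 3} (e_H - 1)/(v_H - 2)`; Nenadov–Steger p. 1), computed
over induced subgraphs `H[U]`, `|U| ≥ 3` (which give the same maximum, `d₂` being increasing in
the number of edges). JUNK VALUE `0` when `H` has fewer than `3` vertices. The threshold for
`G(n, p) → (H)_r` is `n^{-1/m₂(H)}` (Rödl–Ruciński Thm 1').
[cite: RodlRucinski1995, §1 (p. 917)] -/
def m2Density (H : _root_.SimpleGraph V) [DecidableRel H.Adj] : ℚ :=
  if h : 3 ≤ Fintype.card V then
    ((univ : Finset (Finset V)).filter fun U => 3 ≤ #U).sup' ⟨univ, by simp [h]⟩ (d2Density H)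
  else 0

/-- Every vertex set `U` with `|U| ≥ 3` competes in the maximum: `d₂(H[U]) ≤ m₂(H)`. [folklore] -/
theorem d2Density_le_m2Density (H : _root_.SimpleGraph V) [DecidableRel H.Adj] {U : Finset V}
    (hU : 3 ≤ #U) : d2Density H U ≤ m2Density H := by
  have hV : 3 ≤ Fintype.card V := hU.trans (card_le_univ U)
  rw [m2Density, dif_pos hV]
  exact le_sup' (d2Density H) (by simp [hU])

/-- The maximum is attained: for `|V| ≥ 3` some `U` with `|U| ≥ 3` has `d₂(H[U]) = m₂(H)`.
[folklore] -/
theorem exists_d2Density_eq_m2Density (H : _root_.SimpleGraph V) [DecidableRel H.Adj]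
    (hV : 3 ≤ Fintype.card V) : ∃ U : Finset V, 3 ≤ #U ∧ d2Density H U = m2Density H := by
  rw [m2Density, dif_pos hV]
  obtain ⟨U, hU, hUeq⟩ := exists_mem_eq_sup'
    (⟨univ, by simp [hV]⟩ : ((univ : Finset (Finset V)).filter fun U => 3 ≤ #U).Nonempty)
    (d2Density H)
  exact ⟨U, (mem_filter.1 hU).2, hUeq.symm⟩

/-- Bounding `m₂` from above = bounding every `d₂(H[U])`, `|U| ≥ 3` (for `|V| ≥ 3`). [folklore] -/
theorem m2Density_le_iff (H : _root_.SimpleGraph V) [DecidableRel H.Adj]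
    (hV : 3 ≤ Fintype.card V) (q : ℚ) :
    m2Density H ≤ q ↔ ∀ U : Finset V, 3 ≤ #U → d2Density H U ≤ q := by
  rw [m2Density, dif_pos hV, sup'_le_iff]
  simp

/-- The junk value: `m₂(H) = 0` for graphs on fewer than `3` vertices. [folklore] -/
theorem m2Density_of_card_lt (H : _root_.SimpleGraph V) [DecidableRel H.Adj]
    (hV : Fintype.card V < 3) : m2Density H = 0 := by
  rw [m2Density, dif_neg (not_le.2 hV)]

/-- `m₂` is monotone in the graph. [folklore] -/
theorem m2Density_mono {H₁ H₂ : _root_.SimpleGraph V} [DecidableRel H₁.Adj]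
    [DecidableRel H₂.Adj] (h : H₁ ≤ H₂) : m2Density H₁ ≤ m2Density H₂ := by
  by_cases hV : 3 ≤ Fintype.card V
  · rw [m2Density_le_iff H₁ hV]
    intro U hU
    exact (d2Density_mono h hU).trans (d2Density_le_m2Density H₂ hU)
  · rw [m2Density_of_card_lt H₁ (not_le.1 hV), m2Density_of_card_lt H₂ (not_le.1 hV)]

/-- `m₂(K_V) = (|V| + 1)/2` for `|V| ≥ 3`: the whole vertex set is the densest part of a complete
graph. [cite: RodlRucinski1995, Cor. 1 (p. 918)] -/
theorem m2Density_top [DecidableEq V] [DecidableRel (⊤ : _root_.SimpleGraph V).Adj]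
    (hV : 3 ≤ Fintype.card V) :
    m2Density (⊤ : _root_.SimpleGraph V) = ((Fintype.card V : ℚ) + 1) / 2 := by
  apply le_antisymm
  · rw [m2Density_le_iff _ hV]
    intro U hU
    rw [d2Density_top hU]
    have : (#U : ℚ) ≤ Fintype.card V := by exact_mod_cast card_le_univ U
    linarith
  · have h := d2Density_le_m2Density (⊤ : _root_.SimpleGraph V) (U := univ)
      (by rwa [card_univ])
    rwa [d2Density_top (by rwa [card_univ]), card_univ] at h

/-- **`m₂(K_k) = (k + 1)/2`** for `k ≥ 3` (so the Rödl–Ruciński threshold for `K_k` is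
`n^{-2/(k+1)}`: `n^{-1/2}` for triangles, `n^{-2/5}` for `K₄`; JAMS 1995 Cor. 1 states it as
`N ≍ n^{2k/(k+1)}` edges). [cite: RodlRucinski1995, Cor. 1 (p. 918)] -/
theorem m2Density_top_fin {k : ℕ} (hk : 3 ≤ k) :
    m2Density (⊤ : _root_.SimpleGraph (Fin k)) = ((k : ℚ) + 1) / 2 := by
  rw [m2Density_top (by rwa [Fintype.card_fin]), Fintype.card_fin]

end TwoDensity

end Literature.Combinatorics.SimpleGraph
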